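import Summits.KontsevichZagierPeriods.KontsevichZagierPeriods.Theorems.SoloBlindSecondAsymp
import Summits.KontsevichZagierPeriods.KontsevichZagierPeriods.Theorems.SoloBlindCyclicTraces
import HarnessLib

/-!
# The second-kind form, V: the two traces and the regularised Beta integrand

Integrability of the axis trace `y ↦ Re g(½+iy)` on `(0, ∞)` (bounded near `0`, and
`O(y^{σ-1})` at infinity by the cancellation bound) and of the edge trace `x ↦ Im g(x)` on
`(-∞,0) ∪ (0,½)`.  On `x < 0` the edge trace is `sin(πα) ((-x)^α (1-x)^β - (-x)^σ)`; under
`x = -v/(1-v)` this becomes the **regularised Beta integrand**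
`R(v) = (v^α - v^σ)(1-v)^{-σ-2}` on `(0,1)`, which is dominated by
`2 (v^α + v^σ)(1-v)^{-σ-1}` and hence integrable for `-1 < α`, `-1 < σ < 0`.

References: Whittaker–Watson, *Modern Analysis*, §12.43.
-/

noncomputable section

open Set Complex MeasureTheory Filter
open scoped Topology
open Literature.NumberTheory.Transcendental
open Literature.NumberTheory.Transcendental.KZ
open Literature.Analysis.SpecialFunctions.Selberg

namespace Summit.KontsevichZagierPeriods.KontsevichZagierPeriods.Theorems

namespace SoloBlind

/-! ## The trace on the axis `x = ½` -/

/-- Continuity of `y ↦ g(½+iy)` on `(0, ∞)`. -/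
theorem continuousOn_gK_mid (α β l m : ℝ) :
    ContinuousOn (fun y : ℝ => gK α β l m (((1 / 2 : ℝ) : ℂ) + y * I)) (Ioi 0) := by
  intro y hy
  have hs := mem_slitPlane_pair (x := 1 / 2) (mem_Ioi.mp hy)
  have hlin : Continuous fun y : ℝ => (((1 / 2 : ℝ) : ℂ)) + y * I := by fun_prop
  have h := (hasDerivAt_gK α β l m hs.1 hs.2).continuousAt.comp
    (f := fun y : ℝ => (((1 / 2 : ℝ) : ℂ)) + y * I) hlin.continuousAt
  exact h.continuousWithinAt

/-- `|g(½+iy)| ≤ 4 + 2|λ| + 2|μ|` for `α, β ∈ [-1, 0]`, `σ ≥ -1`. -/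
theorem norm_gK_mid_le {α β : ℝ} (l m : ℝ) (hα : -1 ≤ α) (hα0 : α ≤ 0) (hβ : -1 ≤ β)
    (hβ0 : β ≤ 0) (hs : -1 ≤ α + β) (y : ℝ) :
    ‖gK α β l m (((1 / 2 : ℝ) : ℂ) + y * I)‖ ≤ 4 + 2 * |l| + 2 * |m| := by
  have h1 : 1 / 2 ≤ ‖(((1 / 2 : ℝ) : ℂ)) + y * I‖ := by
    have h := abs_re_le_norm ((((1 / 2 : ℝ) : ℂ)) + y * I)
    rwa [show ((((1 / 2 : ℝ) : ℂ)) + y * I).re = 1 / 2 by simp,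
      abs_of_pos (by norm_num : (0 : ℝ) < 1 / 2)] at h
  have h2 : 1 / 2 ≤ ‖1 - ((((1 / 2 : ℝ) : ℂ)) + y * I)‖ := by
    have h := abs_re_le_norm (1 - ((((1 / 2 : ℝ) : ℂ)) + y * I))
    rwa [show (1 - ((((1 / 2 : ℝ) : ℂ)) + y * I)).re = 1 / 2 by simp; norm_num,
      abs_of_pos (by norm_num : (0 : ℝ) < 1 / 2)] at h
  have hs0 : α + β ≤ 0 := by linarith
  have hA : ‖(((1 / 2 : ℝ) : ℂ)) + y * I‖ ^ α ≤ 2 :=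
    (Real.rpow_le_rpow_of_nonpos (by norm_num) h1 hα0).trans (half_rpow_le_two hα)
  have hB : ‖1 - ((((1 / 2 : ℝ) : ℂ)) + y * I)‖ ^ β ≤ 2 :=
    (Real.rpow_le_rpow_of_nonpos (by norm_num) h2 hβ0).trans (half_rpow_le_two hβ)
  have hC : ‖(((1 / 2 : ℝ) : ℂ)) + y * I‖ ^ (α + β) ≤ 2 :=
    (Real.rpow_le_rpow_of_nonpos (by norm_num) h1 hs0).trans (half_rpow_le_two hs)
  have hD : ‖1 - ((((1 / 2 : ℝ) : ℂ)) + y * I)‖ ^ (α + β) ≤ 2 :=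
    (Real.rpow_le_rpow_of_nonpos (by norm_num) h2 hs0).trans (half_rpow_le_two hs)
  have hT : ‖gTwo α β (((1 / 2 : ℝ) : ℂ) + y * I)‖ ≤ 4 := by
    rw [norm_gTwo]
    calc _ ≤ (2 : ℝ) * 2 := mul_le_mul hA hB (by positivity) (by norm_num)
      _ = 4 := by norm_num
  calc _ ≤ _ := norm_gK_le α β l m _
    _ ≤ 4 + |l| * 2 + |m| * 2 := by gcongr
    _ = 4 + 2 * |l| + 2 * |m| := by ring

/-- **The axis trace `y ↦ Re g(½+iy)` is integrable on `(0, ∞)`** (`-1 ≤ σ < 0`, cancellation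
conditions). -/
theorem integrableOn_gK_mid {α β l m : ℝ} (hα : -1 ≤ α) (hα0 : α ≤ 0) (hβ : -1 ≤ β) (hβ0 : β ≤ 0)
    (hs : -1 ≤ α + β) (hs0 : α + β < 0) (hK : ephase β - l - m * ephase (α + β) = 0) :
    IntegrableOn (fun y : ℝ => (gK α β l m (((1 / 2 : ℝ) : ℂ) + y * I)).re) (Ioi 0) := by
  have hmeas : ∀ S ⊆ Ioi (0 : ℝ), MeasurableSet S →
      AEStronglyMeasurable (fun y : ℝ => (gK α β l m (((1 / 2 : ℝ) : ℂ) + y * I)).re)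
        (volume.restrict S) := fun S hS hSm =>
    ((Complex.continuous_re.comp_continuousOn (continuousOn_gK_mid α β l m)).mono
      hS).aestronglyMeasurable hSm
  rw [← Ioc_union_Ioi_eq_Ioi (zero_le_two (α := ℝ))]
  refine IntegrableOn.union ?_ ?_
  · have hc : IntegrableOn (fun _ : ℝ => (4 + 2 * |l| + 2 * |m| : ℝ)) (Ioc (0 : ℝ) 2) :=
      integrableOn_const (C := (4 + 2 * |l| + 2 * |m| : ℝ)) measure_Ioc_lt_top.ne
    refine Integrable.mono' hc (hmeas _ Ioc_subset_Ioi_self measurableSet_Ioc) ?_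
    refine (ae_restrict_iff' measurableSet_Ioc).mpr (Eventually.of_forall fun y _ => ?_)
    rw [Real.norm_eq_abs]
    exact (abs_re_le_norm _).trans (norm_gK_mid_le l m hα hα0 hβ hβ0 hs y)
  · have hI : IntegrableOn (fun y : ℝ => 16 * (1 + |m|) * y ^ (α + β - 1)) (Ioi 2) :=
      (integrableOn_Ioi_rpow_of_lt (by linarith) zero_lt_two).const_mul _
    refine Integrable.mono' hI (hmeas _ (Ioi_subset_Ioi zero_le_two) measurableSet_Ioi) ?_
    refine (ae_restrict_iff' measurableSet_Ioi).mpr (Eventually.of_forall fun y hy => ?_)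
    have hy2 : (2 : ℝ) < y := hy
    have hy0 : 0 < y := by linarith
    have hyn : y ≤ ‖(((1 / 2 : ℝ) : ℂ)) + y * I‖ := by
      have h := abs_im_le_norm ((((1 / 2 : ℝ) : ℂ)) + y * I)
      rwa [show ((((1 / 2 : ℝ) : ℂ)) + y * I).im = y by simp, abs_of_pos hy0] at h
    rw [Real.norm_eq_abs]
    refine (abs_re_le_norm _).trans ((norm_gK_le_far hβ hβ0 hs hs0.le hK (by simpa using hy0)
      (hy2.le.trans hyn)).trans ?_)
    exact mul_le_mul_of_nonneg_left (Real.rpow_le_rpow_of_nonpos hy0 hyn (by linarith))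
      (by positivity)

/-! ## The regularised Beta integrand -/

/-- `R(v) = (v^α - v^{α+β}) (1-v)^{-α-β-2}`. -/
def regInt (α β v : ℝ) : ℝ := (v ^ α - v ^ (α + β)) * (1 - v) ^ (-α - β - 2)

/-- `R` is continuous on `(0,1)`. -/
theorem continuousOn_regInt (α β : ℝ) : ContinuousOn (regInt α β) (Ioo 0 1) := by
  intro v hv
  have h0 : v ≠ 0 := hv.1.ne'
  have h1 : 1 - v ≠ 0 := (sub_pos.mpr hv.2).ne'
  have hc : ContinuousAt (fun v : ℝ => (1 - v) ^ (-α - β - 2)) v :=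
    (Real.continuousAt_rpow_const (1 - v) (-α - β - 2) (Or.inl h1)).comp
      (f := fun v : ℝ => 1 - v) (by fun_prop : Continuous fun v : ℝ => 1 - v).continuousAt
  exact (((Real.continuousAt_rpow_const v α (Or.inl h0)).sub
    (Real.continuousAt_rpow_const v (α + β) (Or.inl h0))).mul hc).continuousWithinAt

/-- **Domination**: `|R(v)| ≤ 2 v^α (1-v)^{-σ-1} + 2 v^σ (1-v)^{-σ-1}` on `(0,1)`
(`β ∈ [-1, 0]`). -/
theorem abs_regInt_le {α β : ℝ} (hβ : -1 ≤ β) (hβ0 : β ≤ 0) {v : ℝ}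
    (hv : v ∈ Ioo (0 : ℝ) 1) :
    |regInt α β v| ≤ 2 * (v ^ α * (1 - v) ^ (-α - β - 1)) +
      2 * (v ^ (α + β) * (1 - v) ^ (-α - β - 1)) := by
  obtain ⟨hv0, hv1⟩ := hv
  have h1 : 0 < 1 - v := by linarith
  have hpa : 0 < v ^ α := Real.rpow_pos_of_pos hv0 _
  have hps : 0 < v ^ (α + β) := Real.rpow_pos_of_pos hv0 _
  have hpc : 0 < (1 - v) ^ (-α - β - 1) := Real.rpow_pos_of_pos h1 _
  have hsplit : (1 - v) ^ (-α - β - 2) = (1 - v) ^ (-α - β - 1) / (1 - v) := by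
    rw [show -α - β - 2 = (-α - β - 1) - 1 by ring, Real.rpow_sub_one h1.ne']
  rw [regInt, hsplit, abs_mul, abs_of_pos (div_pos hpc h1)]
  by_cases hh : v ≤ 1 / 2
  · -- near `0`: no cancellation needed, `1/(1-v) ≤ 2`
    have hdiv : (1 - v) ^ (-α - β - 1) / (1 - v) ≤ 2 * (1 - v) ^ (-α - β - 1) := by
      rw [div_le_iff₀ h1]; nlinarith
    have habs : |v ^ α - v ^ (α + β)| ≤ v ^ α + v ^ (α + β) :=
      (abs_sub _ _).trans (by rw [abs_of_pos hpa, abs_of_pos hps])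
    calc |v ^ α - v ^ (α + β)| * ((1 - v) ^ (-α - β - 1) / (1 - v))
        ≤ (v ^ α + v ^ (α + β)) * (2 * (1 - v) ^ (-α - β - 1)) :=
          mul_le_mul habs hdiv (by positivity) (by positivity)
      _ = _ := by ring
  · -- near `1`: `|v^α - v^σ| = v^α (v^β - 1) ≤ v^α (1/v - 1) ≤ 2 v^α (1 - v)`
    push Not at hh
    have hvb : v ^ (α + β) = v ^ α * v ^ β := Real.rpow_add hv0 _ _
    have hb1 : 1 ≤ v ^ β := Real.one_le_rpow_of_pos_of_le_one_of_nonpos hv0 hv1.le hβ0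
    have hb2 : v ^ β ≤ v ^ (-1 : ℝ) := Real.rpow_le_rpow_of_exponent_ge hv0 hv1.le hβ
    rw [Real.rpow_neg_one] at hb2
    have hinv : v⁻¹ ≤ 1 + 2 * (1 - v) := by
      rw [inv_le_iff_one_le_mul₀ hv0]; nlinarith
    have habs : |v ^ α - v ^ (α + β)| ≤ 2 * v ^ α * (1 - v) := by
      rw [hvb, show v ^ α - v ^ α * v ^ β = -(v ^ α * (v ^ β - 1)) by ring, abs_neg,
        abs_of_nonneg (by nlinarith)]
      nlinarith
    calc |v ^ α - v ^ (α + β)| * ((1 - v) ^ (-α - β - 1) / (1 - v))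
        ≤ 2 * v ^ α * (1 - v) * ((1 - v) ^ (-α - β - 1) / (1 - v)) :=
          mul_le_mul_of_nonneg_right habs (by positivity)
      _ = 2 * (v ^ α * (1 - v) ^ (-α - β - 1)) := by field_simp
      _ ≤ _ := by nlinarith [mul_pos hps hpc]

/-- **`R` is integrable on `(0,1)`** for `-1 < α`, `β ∈ [-1, 0]`, `-1 < σ < 0`. -/
theorem integrableOn_regInt {α β : ℝ} (hα : -1 < α) (hβ : -1 ≤ β) (hβ0 : β ≤ 0)
    (hs : -1 < α + β) (hs0 : α + β < 0) : IntegrableOn (regInt α β) (Ioo 0 1) := by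
  have hB1 := (integrableOn_Ioo_rpow_mul_one_sub_rpow_and_integral_eq (a := α + 1)
    (b := -α - β) (by linarith) (by linarith)).1
  have hB2 := (integrableOn_Ioo_rpow_mul_one_sub_rpow_and_integral_eq (a := α + β + 1)
    (b := -α - β) (by linarith) (by linarith)).1
  have hdom : IntegrableOn (fun v : ℝ => 2 * (v ^ α * (1 - v) ^ (-α - β - 1)) +
      2 * (v ^ (α + β) * (1 - v) ^ (-α - β - 1))) (Ioo 0 1) := by
    have h : IntegrableOn (fun v : ℝ => 2 * (v ^ (α + 1 - 1) * (1 - v) ^ (-α - β - 1)) +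
        2 * (v ^ (α + β + 1 - 1) * (1 - v) ^ (-α - β - 1))) (Ioo 0 1) :=
      (hB1.const_mul 2).add (hB2.const_mul 2)
    refine h.congr_fun (fun v _ => ?_) measurableSet_Ioo
    rw [show α + 1 - 1 = α by ring, show α + β + 1 - 1 = α + β by ring]
  refine Integrable.mono' hdom ((continuousOn_regInt α β).aestronglyMeasurable measurableSet_Ioo) ?_
  refine (ae_restrict_iff' measurableSet_Ioo).mpr (Eventually.of_forall fun v hv => ?_)
  rw [Real.norm_eq_abs]
  exact abs_regInt_le hβ hβ0 hv

/-! ## The trace on the edge `y = 0` -/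

/-- `(-x)^α (1-x)^β - (-x)^σ` is integrable on `(-∞, 0)`: under `x = -v/(1-v)` it is `R`. -/
theorem integrableOn_negSideK {α β : ℝ} (hα : -1 < α) (hβ : -1 ≤ β) (hβ0 : β ≤ 0)
    (hs : -1 < α + β) (hs0 : α + β < 0) :
    IntegrableOn (fun x : ℝ => (-x) ^ α * (1 - x) ^ β - (-x) ^ (α + β)) (Iio 0) := by
  have hder : ∀ v ∈ Ioo (0 : ℝ) 1,
      HasDerivWithinAt (fun v => -moeb v) (-(1 / (1 - v) ^ 2)) (Ioo 0 1) v :=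
    fun v hv => (hasDerivAt_moeb (ne_of_lt hv.2)).neg.hasDerivWithinAt
  rw [← image_negMoeb,
    integrableOn_image_iff_integrableOn_abs_deriv_smul measurableSet_Ioo hder injOn_negMoeb]
  refine (integrableOn_regInt hα hβ hβ0 hs hs0).congr_fun (fun v hv => ?_) measurableSet_Ioo
  have h1 : 0 < 1 - v := by linarith [hv.2]
  have hJ1 := jacobi_negMoeb₂ α β hv
  have hJ2 := jacobi_negMoeb₂ (α + β) 0 hv
  rw [Real.rpow_zero, mul_one, show -(α + β) - 0 - 2 = -α - β - 2 by ring] at hJ2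
  rw [regInt, smul_eq_mul, abs_neg, abs_of_pos (by positivity : (0 : ℝ) < 1 / (1 - v) ^ 2),
    mul_sub, mul_comm (1 / (1 - v) ^ 2), mul_comm (1 / (1 - v) ^ 2), hJ1, hJ2]
  ring

/-- **The edge trace `x ↦ Im g(x)` is integrable on `(-∞,0) ∪ (0,½)`**, when
`λ sin(πσ) = sin(πα)`. -/
theorem integrableOn_gK_edge {α β l : ℝ} (m : ℝ) (hα : -1 < α) (hβ : -1 ≤ β)
    (hβ0 : β ≤ 0) (hs : -1 < α + β) (hs0 : α + β < 0)
    (hl : l * Real.sin (Real.pi * (α + β)) = Real.sin (Real.pi * α)) :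
    IntegrableOn (fun x : ℝ => (gK α β l m ((x : ℂ) + ((0 : ℝ) : ℂ) * I)).im) baseA := by
  have e : ∀ x : ℝ, (x : ℂ) + ((0 : ℝ) : ℂ) * I = x := fun x => by simp
  simp_rw [e]
  rw [baseA_eq]
  refine IntegrableOn.union ?_ ?_
  · have h : IntegrableOn (fun x : ℝ => Real.sin (Real.pi * α) *
        ((-x) ^ α * (1 - x) ^ β - (-x) ^ (α + β))) (Iio 0) :=
      (integrableOn_negSideK hα hβ hβ0 hs hs0).const_mul (Real.sin (Real.pi * α))
    exact h.congr_fun (fun x hx => (im_gK_ofReal_neg m hx hl).symm) measurableSet_Iio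
  · refine (integrableOn_zero : IntegrableOn (fun _ : ℝ => (0 : ℝ)) (Ioo 0 (1 / 2))).congr_fun
      (fun x hx => (im_gK_ofReal_pos l m hx.1 (by linarith [hx.2])).symm) measurableSet_Ioo

end SoloBlind

end Summit.KontsevichZagierPeriods.KontsevichZagierPeriods.Theorems
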